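import Summits.CriticalPhenomena.SAWScalingLimit.Theorems.SAWLeftRightFKGFKGToTraversalBoundKilledWalkCollarPassage
import Summits.CriticalPhenomena.SAWScalingLimit.Theorems.SAWLeftRightFKGFKGToTraversalBoundKilledWalkCollarDetour
import HarnessLib

/-!
# Stub `stub_killedWalkCollarBound` (line `excursion-domination`, crux `FKGToTraversalBound`,
stmt-CriticalPhenomena-1878): the killed-walk collar bound, from the Kemppainen–Smirnov dead-end estimate

The registered stub (reshape r6; the random-walk kernel of the line's uniform pocket lemma) asserts:
there are `M > 1`, `η > 0` such that for every finite HOLE-FREE `Λ ⊆ ℤ²`, mesh `δ > 0`, annulus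
`r ≤ |δx - z₀| ≤ R` with `δ ≤ r`, `M r ≤ R`, and every set `H` lying in a dead end behind a COLLAR
`V ⊆ Λ ∩` annulus (the seven clauses of the signature: `a` joined to `b` off `V`; `H` off the near
component and off `V`; a non-`Λ` site within `r + δ` of the centre; the two-sided mouth condition, in
either orientation), removing `H` costs at most the factor `η` in the Green function of the walk killed
off `Λ`: `η G_Λ(a,b) ≤ G_{Λ∖H}(a,b)`.

STATUS: conditional. The ONE missing potential-theoretic input is the named fact
`Literature.Probability.LatticeModels.KemppainenSmirnov2017_rwDeadEndBound`
(`Literature/Probability/LatticeModels/KemppainenSmirnovDeadEndBound.lean`, proposed with this file; its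
docstring carries the printed provenance and the exact dictionary) — the random-walk form of
Kemppainen–Smirnov's Condition G2 (Ann. Probab. 45 (2017): proof of Thm. 4.12, p. 27, with Prop. 4.11
and the quad-to-annulus summation in the proof of Prop. 2.5, pp. 10–11), transcribed to site domains of
`ℤ²`: the killed walk from `a` CONDITIONED TO HIT `b` visits a set reachable from `a` only through
AVOIDABLE crossings of an annulus of modulus `≥ M` whose inner circle meets the boundary with
probability `≤ 1 - η`, i.e. `η G_Λ(a,b) G_{Λ∖D}(b,b) ≤ G_{Λ∖D}(a,b) G_Λ(b,b)`. This file PROVES the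
registered signature under that statement SPELLED OUT as the hypothesis
(`stub_killedWalkCollarBound_of_deadEndBound`, a registered worker sub-goal; applying it to the named
fact is a one-liner for the consumer): by `exists_unforced_passage` (`…KilledWalkCollarPassage.lean`)
every lattice walk in `Λ` from `a` into `H` contains an avoidable crossing of the collar annulus, so the
hypothesis gives
`η G_Λ(a,b) G_{Λ∖H}(b,b) ≤ G_{Λ∖H}(a,b) G_Λ(b,b)`; and the DIAGONAL case
`G_{Λ∖H}(b,b) ≥ (1 - ε(M)) G_Λ(b,b)`, `ε(M) = C_B (12/(M-2))^{β_B}`, is PROVED from the tree's weak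
Beurling estimate (`stub_killedWalkFarDetour`, `…KilledWalkCollarDetour.lean`); with
`M ≥ 2 + 12 (2 C_B)^{1/β_B}` (so `ε ≤ 1/2`) and `M ≥ 3` this yields the stub with `η/2`.

Why the input is isolated at the level of Condition G2 (all dead ends behind one annulus at once) and
not at the level of KS17's Prop. 4.11 / Chelkak 2016 Prop. 3.3 (one quad): the collar `V` of the
signature may consist of several channels leading to several far components, and the natural one-quad
intermediates — the "mouth Harnack" bound `min_B G_Λ(·,b) ≥ 2 max_{far rim} G_Λ(·,b)` with a GLOBAL
maximum over the far rim, and the two-way crossing estimate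
`P_a(τ_{far rim} < ζ) · max_{far rim} P_·(τ_b < ζ) ≤ (1-η) P_a(τ_b < ζ)` — are FALSE for two channels
behind walls leading to two distinct far components, with `a`, `b` at the two near mouths joined inside
by a long thin corridor of `L` sites (both the detour and the direct route pay the corridor factor
`e^{-cL}`, the global maximum does not; cf. the certified numerics of worker W4 of lead c1,
`Cruxes/FKGToTraversalBound/LeadFindings-c1.md` §F-D: 9.8e-14 for the mouth-Harnack intermediate
against a true ratio .9958). KS17's own passage from one quad to the annulus is the separating-arc
summation of Prop. 2.5 over per-channel EXPONENTIAL bounds in the discrete extremal length of the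
channels (Chelkak 2016, §3), which the tree does not have.
-/

noncomputable section

open SimpleGraph
open Literature.Probability.LatticeModels

namespace Summit.CriticalPhenomena.SAWScalingLimit.Theorems.FKGToTraversalBound.ExcursionDomination.KilledWalkCollar

/-! ## The stub under the Kemppainen–Smirnov dead-end bound -/

/-- `ε(M) = C_B (12/(M-2))^{β_B} ≤ 1/2` once `M ≥ 2 + 12 (2 C_B)^{1/β_B}`. [folklore] -/
theorem eps_le_half {M : ℝ}
    (hM : 2 + 12 * (2 * WeakBeurling.beurlingConst) ^ (1 / WeakBeurling.beurlingExp) ≤ M) :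
    WeakBeurling.beurlingConst * (12 / (M - 2)) ^ WeakBeurling.beurlingExp ≤ 1 / 2 := by
  have hC := WeakBeurling.beurlingConst_pos
  have hβ := WeakBeurling.beurlingExp_pos
  set t : ℝ := (2 * WeakBeurling.beurlingConst) ^ (1 / WeakBeurling.beurlingExp) with ht
  have ht0 : 0 < t := Real.rpow_pos_of_pos (by linarith) _
  have htβ : t ^ WeakBeurling.beurlingExp = 2 * WeakBeurling.beurlingConst := by
    rw [ht, ← Real.rpow_mul (by linarith), one_div, inv_mul_cancel₀ hβ.ne', Real.rpow_one]
  have h1 : 12 / (M - 2) ≤ t⁻¹ :=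
    calc 12 / (M - 2) ≤ 12 / (12 * t) := div_le_div_of_nonneg_left (by norm_num) (by positivity) (by linarith)
      _ = t⁻¹ := by rw [← div_div, div_self (by norm_num : (12 : ℝ) ≠ 0), one_div]
  have h2 : (12 / (M - 2)) ^ WeakBeurling.beurlingExp ≤ (2 * WeakBeurling.beurlingConst)⁻¹ := by
    have h0 : (0 : ℝ) ≤ 12 / (M - 2) := div_nonneg (by norm_num) (by linarith)
    calc (12 / (M - 2)) ^ WeakBeurling.beurlingExp ≤ (t⁻¹) ^ WeakBeurling.beurlingExp :=
          Real.rpow_le_rpow h0 h1 hβ.le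
      _ = (2 * WeakBeurling.beurlingConst)⁻¹ := by rw [Real.inv_rpow ht0.le, htβ]
  calc WeakBeurling.beurlingConst * (12 / (M - 2)) ^ WeakBeurling.beurlingExp
      ≤ WeakBeurling.beurlingConst * (2 * WeakBeurling.beurlingConst)⁻¹ :=
        mul_le_mul_of_nonneg_left h2 hC.le
    _ = 1 / 2 := by field_simp

/-- **Worker sub-goal `stub_killedWalkCollarBound_of_deadEndBound`** (registered, def-free): the
registered signature of `stub_killedWalkCollarBound`, verbatim, under the Kemppainen–Smirnov dead-end bound
spelled out as the hypothesis (verbatim the body of the named fact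
`Literature.Probability.LatticeModels.KemppainenSmirnov2017_rwDeadEndBound`). With `(M, η)` from the
hypothesis take `M' := max (max M 3) (2 + 12 (2C_B)^{1/β_B})` and `η' := η/2`: for every `h ∈ H` every
`Λ`-walk from `a` to `h` contains an unforced passage of the collar annulus (`exists_unforced_passage`,
`r + 2δ ≤ 3r ≤ R`), so the hypothesis applies with `D := H` and gives
`η G_Λ(a,b) G_{Λ∖H}(b,b) ≤ G_{Λ∖H}(a,b) G_Λ(b,b)`; the diagonal bound `G_{Λ∖H}(b,b) ≥ (1 - ε) G_Λ(b,b)`,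
`ε ≤ 1/2` (`stub_killedWalkFarDetour`, `eps_le_half`) and `G_Λ(b,b) > 0` (or `G_Λ(·,b) ≡ 0`) finish.
[folklore] -/
theorem stub_killedWalkCollarBound_of_deadEndBound :
    (∃ (M η : ℝ), 1 < M ∧ 0 < η ∧ ∀ (δ : ℝ) (Λ : Finset (Site 2)) (a b : Site 2), 0 < δ →
      HoleFree (↑Λ : Set (Site 2)) →
      ∀ (z₀ : ℂ) (r R : ℝ) (D : Finset (Site 2)), δ ≤ r → M * r ≤ R →
        (∃ p : Site 2, p ∉ Λ ∧ dist (meshPoint δ p) z₀ ≤ r + δ) →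
        (∀ e ∈ D, ∀ q : (zdGraph 2).Walk a e, (∀ x ∈ q.support, x ∈ Λ) →
          ∃ (u v : Site 2) (c : (zdGraph 2).Walk u v), c.IsSubwalk q ∧
            ((dist (meshPoint δ u) z₀ < r + δ ∧ R - δ < dist (meshPoint δ v) z₀) ∨
             (R - δ < dist (meshPoint δ u) z₀ ∧ dist (meshPoint δ v) z₀ < r + δ)) ∧
            ∀ x ∈ c.support, x ∈ Λ ∧ r ≤ dist (meshPoint δ x) z₀ ∧ dist (meshPoint δ x) z₀ ≤ R ∧
              ∃ p : (zdGraph 2).Walk a b, ∀ y ∈ p.support, y ∈ Λ ∧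
                ¬ ∃ t : (zdGraph 2).Walk x y, ∀ s ∈ t.support,
                    s ∈ Λ ∧ r ≤ dist (meshPoint δ s) z₀ ∧ dist (meshPoint δ s) z₀ ≤ R) →
        η * (dirichletGreen Λ a b * dirichletGreen (Λ \ D) b b) ≤
          dirichletGreen (Λ \ D) a b * dirichletGreen Λ b b) →
    ∃ (M η : ℝ), 1 < M ∧ 0 < η ∧ ∀ (δ : ℝ) (Λ : Finset (Site 2)) (a b : Site 2), 0 < δ →
      HoleFree (↑Λ : Set (Site 2)) →
      ∀ (z₀ : ℂ) (r R : ℝ) (H : Finset (Site 2)), δ ≤ r → M * r ≤ R →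
        (∃ V : Finset (Site 2), V ⊆ Λ ∧
          (∀ x ∈ V, r ≤ dist (meshPoint δ x) z₀ ∧ dist (meshPoint δ x) z₀ ≤ R) ∧
          (∃ p : (zdGraph 2).Walk a b, ∀ x ∈ p.support, x ∈ Λ ∧ x ∉ V) ∧
          (∀ y, (∃ p : (zdGraph 2).Walk a y, ∀ x ∈ p.support, x ∈ Λ ∧ x ∉ V) → y ∉ H) ∧
          (∀ x ∈ V, x ∉ H) ∧
          (∃ p : Site 2, p ∉ Λ ∧ dist (meshPoint δ p) z₀ ≤ r + δ) ∧
          ((∀ x ∈ V, ∀ y ∈ Λ, y ∉ V → (zdGraph 2).Adj x y →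
              ((∃ p : (zdGraph 2).Walk a y, ∀ x ∈ p.support, x ∈ Λ ∧ x ∉ V) →
                dist (meshPoint δ y) z₀ < r) ∧
              ((∃ h ∈ H, (∃ p : (zdGraph 2).Walk y h, ∀ x ∈ p.support, x ∈ Λ ∧ x ∉ V)) →
                R < dist (meshPoint δ y) z₀)) ∨
           (∀ x ∈ V, ∀ y ∈ Λ, y ∉ V → (zdGraph 2).Adj x y →
              ((∃ p : (zdGraph 2).Walk a y, ∀ x ∈ p.support, x ∈ Λ ∧ x ∉ V) →
                R < dist (meshPoint δ y) z₀) ∧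
              ((∃ h ∈ H, (∃ p : (zdGraph 2).Walk y h, ∀ x ∈ p.support, x ∈ Λ ∧ x ∉ V)) →
                dist (meshPoint δ y) z₀ < r)))) →
        η * dirichletGreen Λ a b ≤ dirichletGreen (Λ \ H) a b := by
  rintro ⟨M, η, hM, hη, hP⟩
  set Md : ℝ := 2 + 12 * (2 * WeakBeurling.beurlingConst) ^ (1 / WeakBeurling.beurlingExp) with hMd
  refine ⟨max (max M 3) Md, η / 2, lt_max_of_lt_left (lt_max_of_lt_left hM), by linarith, ?_⟩
  intro δ Λ a b hδ hΛ z₀ r R H hr hR hV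
  have hr0 : 0 ≤ r := hδ.le.trans hr
  have hMR : M * r ≤ R :=
    (mul_le_mul_of_nonneg_right ((le_max_left M 3).trans (le_max_left _ Md)) hr0).trans hR
  have h3R : 3 * r ≤ R :=
    (mul_le_mul_of_nonneg_right ((le_max_right M 3).trans (le_max_left _ Md)) hr0).trans hR
  have hrR : r + 2 * δ ≤ R := by linarith
  -- the diagonal bound from the tree's weak Beurling estimate
  have hM2 : (2 : ℝ) < max (max M 3) Md := lt_max_of_lt_left (lt_max_of_lt_right (by norm_num))
  have hdiag := (stub_killedWalkFarDetour _ hM2 δ Λ a b hδ hΛ z₀ r R H hr hR hV).2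
  have hε := eps_le_half (le_max_right (max M 3) Md)
  -- the dead-end bound with `D := H`
  obtain ⟨V, -, -, ⟨p₀, hp₀⟩, hNearH, hVH, hwall, hdisj⟩ := hV
  have hKS := hP δ Λ a b hδ hΛ z₀ r R H hr hMR hwall fun e he q hq =>
    exists_unforced_passage hδ hrR p₀ hp₀ hNearH hVH hdisj he q hq
  -- assemble
  have hGab := dirichletGreen_nonneg two_pos Λ a b
  have hG'ab := dirichletGreen_nonneg two_pos (Λ \ H) a b
  have hGbb := dirichletGreen_nonneg two_pos Λ b b
  have hle := dirichletGreen_le_diag Λ a b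
  rcases hGbb.lt_or_eq with hpos | h0
  · -- `G_{Λ∖H}(b,b) ≥ G_Λ(b,b)/2`
    have hhalf : dirichletGreen Λ b b / 2 ≤ dirichletGreen (Λ \ H) b b := by
      have := mul_le_mul_of_nonneg_right hε hGbb
      linarith
    have key : η * dirichletGreen Λ a b * (dirichletGreen Λ b b / 2) ≤
        dirichletGreen (Λ \ H) a b * dirichletGreen Λ b b :=
      (mul_le_mul_of_nonneg_left hhalf (mul_nonneg hη.le hGab)).trans (by rw [← mul_assoc] at hKS; exact hKS)
    have key' : (η / 2 * dirichletGreen Λ a b) * dirichletGreen Λ b b ≤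
        dirichletGreen (Λ \ H) a b * dirichletGreen Λ b b := by
      convert key using 1; ring
    exact le_of_mul_le_mul_right key' hpos
  · -- `G_Λ(b,b) = 0`: then `G_Λ(a,b) = 0`
    have : dirichletGreen Λ a b = 0 := le_antisymm (by rw [h0]; exact hle) hGab
    rw [this, mul_zero]
    exact hG'ab

end Summit.CriticalPhenomena.SAWScalingLimit.Theorems.FKGToTraversalBound.ExcursionDomination.KilledWalkCollar
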